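import Summits.CriticalPhenomena.PercolationContinuityZ3.Theorems.PercNearOneGluingNoHeavyRsw3InnerClusterTransfer
import Summits.CriticalPhenomena.PercolationContinuityZ3.Theorems.PercAnnulusCrossingIICMeasure
import HarnessLib

/-!
# RSW3 lane (P2, gen 19): the inner-cluster transfer inequality in RATIO form and for KESTEN'S IIC — under (A2)□,
# `P(F | 0 ↔ ∂ⁱⁿΛ(N)) ≥ ϰ · P(F ∩ {0 ↔ ∂ⁱⁿΛ(sm)})/π(sm)` for all `N > Lm`, hence `ν(F) ≥ ϰ · P(F ∩ A_{sm})/π(sm)` for every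
# Kesten-limit measure `ν` and every local event `F` depending only on the cluster of `0` inside `Λ(m−1)`

builds on p205010 (kernel theorem, internal audit signed; external expert review pending) — NOT used in this file.

Cell `prim-rsw3`, prover seat `prim-rsw3-p2` (gen 19), memo `run/shared/lean/prim/rsw3/P2-RSWLITE.md` §26 (V73, Step 1).
Support file (`--supports stmt-CriticalPhenomena-4575`); no definitions, no named facts, no sorries.

* `div_le_div_real_inter_of_innerCluster` (every `p > 0` with (A2)□): the ratio form
  `ϰ · P_p(F ∩ A_{sm})/π_p(sm) ≤ P_p(F ∩ A_N)/π_p(N)` (`A_k = {0 ↔ ∂ⁱⁿΛ(k)}`, `1 ≤ s ≤ L`, `1 ≤ m`, `L·m < N`);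
* **`le_iicMeasure_real_of_innerCluster`**: for every probability measure `ν` with Kesten's IIC limit property at `p` and every LOCAL event `F`
  depending only on `DCT16.clusterSet (Λ(m−1))`: `ϰ · P_p(F ∩ A_{sm})/π_p(sm) ≤ ν(F)` — the incipient infinite cluster charges every
  inner-cluster event at least `ϰ` times its probability under the arm-conditioned law at the comparable scale `sm`.  (With the lane's IIC
  existence under (A2)□ at `p_c(ℤ^d)`, p1, this is unconditional in `ν`'s existence; the converse-type upper bounds are p1's source comparison.)
  Reduces the IIC volume lower bound `ν(|C ∩ Λ(n)| ≥ λ s(n)) ≥ c` to the bounded-ratio statement `P(fat_n ∩ A_{Cn}) ≥ c π(Cn)` (memo V73 Step 2).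

References: H. Kesten, PTRF 73 (1986) [Kesten1986]; D. Basu, A. Sapozhnikov, ECP 22 (2017) §1–2 [BasuSapozhnikov2017ECP];
H. Duminil-Copin, V. Tassion, Enseign. Math. 62 (2016) §2.1 [DuminilCopinTassionEM2016]. [folklore]
-/

noncomputable section

namespace Summit.CriticalPhenomena.PercolationContinuityZ3.Theorems

namespace Rsw3

open MeasureTheory Filter Topology Literature.Probability.LatticeModels Literature.Probability.Percolation
open SurfaceTension Crossing SimpleGraph

variable {d : ℕ}

/-- **Ratio form of the transfer inequality** (every `p > 0`, `d ≥ 1`; (A2)□ `(s, L, ϰ)` with `ϰ ≥ 0`, `1 ≤ s ≤ L`, `1 ≤ m`, `L·m < N`):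
`ϰ · P_p(F ∩ A_{sm}) / π_p(sm) ≤ P_p(F ∩ A_N) / π_p(N)` for `F` depending only on the cluster of `0` inside `Λ(m−1)`.
[cite: BasuSapozhnikov2017ECP, §1 assumption (A2) and §2] [cite: Kesten1986, §2] -/
theorem div_le_div_real_inter_of_innerCluster (hd : 1 ≤ d) (p : unitInterval) (hp : 0 < (p : ℝ)) {s L : ℕ} {ϰ : ℝ}
    (hA2 : SetToSetQuasiMultAspectAt d p s L ϰ) (hϰ : 0 ≤ ϰ) (hs : 1 ≤ s) (hsL : s ≤ L) {m N : ℕ} (hm : 1 ≤ m) (hN : L * m < N)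
    {F : Set (BondConfig (Site d))}
    (hF : ∀ ω ω' : BondConfig (Site d), DCT16.clusterSet (box d (m - 1)) ω = DCT16.clusterSet (box d (m - 1)) ω' →
      (ω ∈ F ↔ ω' ∈ F)) :
    ϰ * ((bondPercolation (zdGraph d) p).real (F ∩ siteToBoundary d (s * m)) / oneArmProb d p (s * m)) ≤
      (bondPercolation (zdGraph d) p).real (F ∩ siteToBoundary d N) / oneArmProb d p N := by
  have hπpos : ∀ k : ℕ, 0 < oneArmProb d p k := fun k =>
    (pow_pos hp k).trans_le (DKT20.pow_le_real_siteToBoundary hd p k)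
  have h := mul_oneArmProb_mul_real_inter_le_of_innerCluster p hA2 hϰ hs hsL hm hN hF
  have hN0 := hπpos N
  have hsm0 := hπpos (s * m)
  rw [mul_div_assoc', div_le_div_iff₀ hsm0 hN0]
  calc ϰ * (bondPercolation (zdGraph d) p).real (F ∩ siteToBoundary d (s * m)) * oneArmProb d p N
      = ϰ * oneArmProb d p N * (bondPercolation (zdGraph d) p).real (F ∩ siteToBoundary d (s * m)) := by ring
    _ ≤ oneArmProb d p (s * m) * (bondPercolation (zdGraph d) p).real (F ∩ siteToBoundary d N) := h
    _ = (bondPercolation (zdGraph d) p).real (F ∩ siteToBoundary d N) * oneArmProb d p (s * m) := by ring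

/-- **KESTEN'S IIC CHARGES INNER-CLUSTER EVENTS AT LEAST `ϰ` TIMES THE ARM-CONDITIONED LAW** (every `p > 0`, `d ≥ 1`; (A2)□ `(s,L,ϰ)`,
`ϰ ≥ 0`, `1 ≤ s ≤ L`, `1 ≤ m`): for every probability measure `ν` with Kesten's IIC limit property at `p` and every event `F` determined by
finitely many pairs and depending on `ω` only through the cluster of `0` inside `Λ(m−1)`:
`ϰ · P_p(F ∩ {0 ↔ ∂ⁱⁿΛ(sm)}) / π_p(sm) ≤ ν(F)`.
[cite: Kesten1986, Thm. (3)] [cite: BasuSapozhnikov2017ECP, Thm. 1.1] -/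
theorem le_iicMeasure_real_of_innerCluster (hd : 1 ≤ d) (p : unitInterval) (hp : 0 < (p : ℝ)) {s L : ℕ} {ϰ : ℝ}
    (hA2 : SetToSetQuasiMultAspectAt d p s L ϰ) (hϰ : 0 ≤ ϰ) (hs : 1 ≤ s) (hsL : s ≤ L) {m : ℕ} (hm : 1 ≤ m)
    {ν : Measure (BondConfig (Site d))}
    (hν : ∀ (K : Finset (Sym2 (Site d))) (E : Set (BondConfig (Site d))), MeasurableSet E → DeterminedBy E ↑K →
      Tendsto (fun n : ℕ => (bondPercolation (zdGraph d) p).real (E ∩ siteToBoundary d n) / oneArmProb d p n)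
        atTop (𝓝 (ν.real E)))
    {F : Set (BondConfig (Site d))} (K : Finset (Sym2 (Site d))) (hdet : DeterminedBy F ↑K)
    (hF : ∀ ω ω' : BondConfig (Site d), DCT16.clusterSet (box d (m - 1)) ω = DCT16.clusterSet (box d (m - 1)) ω' →
      (ω ∈ F ↔ ω' ∈ F)) :
    ϰ * ((bondPercolation (zdGraph d) p).real (F ∩ siteToBoundary d (s * m)) / oneArmProb d p (s * m)) ≤ ν.real F := by
  have hlim := hν K F hdet.measurableSet_of_finset hdet
  refine ge_of_tendsto hlim ?_
  rw [Filter.eventually_atTop]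
  exact ⟨L * m + 1, fun N hN => div_le_div_real_inter_of_innerCluster hd p hp hA2 hϰ hs hsL hm (by omega) hF⟩

end Rsw3

end Summit.CriticalPhenomena.PercolationContinuityZ3.Theorems
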